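import Summits.Ventures.HSemireg.WedgeHankelRecurrenceHankelEuclidSignature
import Literature.LinearAlgebra.QuadraticForm.SignatureTensorProduct
import Literature.LinearAlgebra.QuadraticForm.DicksonInvariant
import Literature.LinearAlgebra.Matrix.NilpotentSimilarToScalarMultiple

/-!
# Venture HSemireg — BPR LEMMA 9.22 FOR `Q/P` WITH A NON-MONIC NUMERATOR: `H_t(cQ/P) = c · H_t(Q/P)`, so for `Q ≠ 0` with leading coefficient `b` and monic associate `Q̃ = Q · C b⁻¹` (`P mod Q =
# P %ₘ Q̃`), along one Euclidean step and at every truncation size `t + 1 = (deg P − deg Q) + (d + 1) ≤ deg P`: **`rank H_t(Q/P) = (deg P − deg Q) + rank H_d(−(P mod Q)/Q̃)`** (any field),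
# **`Sign H_t(Q/P) = sign(b) · (Sign H_d(−(P mod Q)/Q̃) + [deg P − deg Q odd])`** and the two indices (kept for `b > 0`, exchanged for `b < 0`) over a linearly ordered field — BPR's
# `sign(s_{c−1}) = sign(b_q / a_p)` with `P` monic

HONEST FRAMING. Part of the Lean index of the computation cell `pub-hsemireg` (seat p10 gen 37, Sunday typer «UNIFORM-IN-n»).
LINEAR ALGEBRA OF HANKEL MATRICES OVER A (LINEARLY ORDERED) FIELD ONLY (Mathlib's `sigPos` ∕ `sigNeg`, `Matrix.rank`; PROVED Literature `SignatureTensorProduct.sigPos ∕ sigNeg_smul_of_pos' ∕ _neg'`,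
`DicksonInvariant.toQuadraticForm'_smul`, `NilpotentSimilarToScalarMultiple.rank_smul_of_ne_zero`): no variety, no cohomology theory, no sheaf, no Ext group and no semiregularity map is constructed
here; nothing here says that HC / HC_CM / HC_AV holds; no Literature fact (unproved `Prop`) is declared or used.  Custodian versions as in `WedgeHankelSiegelIdeal` (1/3).
SOURCE OF THE ARGUMENT (cited; held text read, `book:basu2006-algorithms-real-algebraic-geometry` pp. 337–339): S. Basu, R. Pollack, M.-F. Roy, *Algorithms in Real Algebraic Geometry* (2006)
§9.2.2 Lemma 9.22 with «`s_{p−q−1} = b_q / a_p ≠ 0`» (p. 338): for `Q = b_q X^q + ⋯` the first non-zero digit of `Q/P` is `b_q` (`P` monic), so the gap term is `sign(b_q)` and the tail `T = −R/Q`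
is that of the monic associate up to the factor `b_q`; typed by reducing to N165 (monic `Q̃`) through `dualSeq P (b • Q̃) = b • dualSeq P Q̃` (N32).
DEDUP DISCLOSURE (`rg` of the whole tree + Mathlib, 2026-09-01): N165 (`…HankelEuclidSignature`) has the monic-`Q` statements; N151 has scaling laws for BEZOUTIANS (`sigPos_sigNeg_bezoutian_C_mul_of_pos ∕
_neg`); no `hankelSq_smul` ∕ Hankel scaling law or non-monic Euclid step in the tree — that is this file.  7 names: 0 hits tree-wide.

WHAT IS IN THE TREE.  N165: **`rank_hankelSq_dualSeq_eq_succ_add_rank_modByMonic`**, **`sigPos_sub_sigNeg_hankelSq_dualSeq_modByMonic`**, `sigPos_sigNeg_hankelSq_dualSeq_modByMonic`; N32 `dualSeq_smul`;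
Literature `sigPos ∕ sigNeg_smul_of_pos' ∕ _neg'`, `toQuadraticForm'_smul`, `rank_smul_of_ne_zero`.  Mathlib: `Polynomial.mod_def` (`p % q = p %ₘ (q * C (lc q)⁻¹)`), `modByMonic_eq_mod`,
`monic_mul_leadingCoeff_inv`, `natDegree_mul_leadingCoeff_inv`, `smul_eq_C_mul`.
THIS FILE (namespace `Summit.Ventures.HSemireg.Wedge.HankelOuter` continued; PLAIN over N165 (tree) + Literature; 0 definitions):
* §821 `hankelSq_smul`, `hankelSq_dualSeq_smul` (`H_t(cQ/P) = c · H_t(Q/P)`), `eq_leadingCoeff_smul_mul_C_inv` (`Q = lc(Q) • Q̃`, `Q̃` monic of the same degree),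
  **`rank_hankelSq_dualSeq_eq_succ_add_rank_mod`** (rank, any field), `sigPos_sigNeg_smul_matrix`, `sigPos_sub_sigNeg_smul_matrix` (`Sign(c • H) = sign(c) · Sign H`),
  **`sigPos_sub_sigNeg_hankelSq_dualSeq_mod`** (`Sign H_t(Q/P) = sign(lc Q) · (Sign H_d(−(P mod Q)/Q̃) + [c' even])`), `sigPos_sigNeg_hankelSq_dualSeq_mod` (the two indices, by the sign of `lc Q`).
CAVEATS.  `P` stays MONIC (the lineage's `dualSeq` divides by a monic polynomial; a non-monic `P` is first replaced by its monic associate, which rescales ALL digits by `lc(P)⁻¹`); the tail is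
written over the monic associate `Q̃` of `Q`.  Nothing Ext-side.  New names only.
-/

open Module Polynomial
open scoped Matrix Polynomial

namespace Summit.Ventures.HSemireg.Wedge.HankelOuter

open Summit.Ventures.HSemireg.Wedge Summit.Ventures.HSemireg.Wedge.Hankel
open Literature.LinearAlgebra.Matrix.Bezoutian (bezoutian)
open Literature.LinearAlgebra.QuadraticForm (sigPos_smul_of_pos' sigNeg_smul_of_pos' sigPos_smul_of_neg' sigNeg_smul_of_neg')
open Literature.LinearAlgebra.QuadraticForm.DicksonInvariant (toQuadraticForm'_smul)
open Literature.LinearAlgebra.Matrix.NilpotentSimilarToScalarMultiple (rank_smul_of_ne_zero)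

/-! ## §821. Scaling the numerator: `H_t(cQ/P) = c · H_t(Q/P)`; rank is unchanged, inertia is kept or swapped with the sign of `c` -/

section Scaling

variable {K : Type*} [Field K]

/-- `H_t(c · q) = c · H_t(q)`. [bookkeeping] -/
theorem hankelSq_smul (t : ℕ) (c : K) (q : ℕ → K) : hankelSq K t (c • q) = c • hankelSq K t q := by
  ext i j; simp only [hankelSq, Matrix.of_apply, Pi.smul_apply, Matrix.smul_apply]

/-- **`H_t(cQ/P) = c · H_t(Q/P)`** (N32 `dualSeq_smul`). [this file, §821] -/
theorem hankelSq_dualSeq_smul (t : ℕ) (P : K[X]) (c : K) (Q : K[X]) : hankelSq K t (dualSeq K P (c • Q)) = c • hankelSq K t (dualSeq K P Q) := by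
  rw [dualSeq_smul, hankelSq_smul]

/-- A non-zero polynomial is its leading coefficient times a MONIC polynomial of the same degree: `Q = lc(Q) • (Q · C lc(Q)⁻¹)`. [bookkeeping] -/
theorem eq_leadingCoeff_smul_mul_C_inv {Q : K[X]} (hQ : Q ≠ 0) :
    Q = Q.leadingCoeff • (Q * C Q.leadingCoeff⁻¹) ∧ (Q * C Q.leadingCoeff⁻¹).Monic ∧ (Q * C Q.leadingCoeff⁻¹).natDegree = Q.natDegree := by
  have hlc : Q.leadingCoeff ≠ 0 := Polynomial.leadingCoeff_ne_zero.2 hQ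
  refine ⟨?_, Polynomial.monic_mul_leadingCoeff_inv hQ, Polynomial.natDegree_mul_leadingCoeff_inv Q hQ⟩
  rw [Polynomial.smul_eq_C_mul, ← mul_assoc, mul_comm (C Q.leadingCoeff), mul_assoc, ← C_mul, mul_inv_cancel₀ hlc, C_1, mul_one]

/-- **RANK of a truncated Hankel form along the Euclidean step, NON-MONIC numerator (any field): `rank H_t(Q/P) = (deg P − deg Q) + rank H_d(−(P mod Q)/Q̃)`** with `Q̃ = Q · C lc(Q)⁻¹` the
monic associate (`P mod Q = P %ₘ Q̃`), for `P` monic of degree `(c' + 1) + deg Q`, `deg Q = q' + 1`, `t + 1 = (c'+1) + (d+1)`, `d ≤ q'` (N165 for `Q̃` + `rank (c • H) = rank H`). [this file, §821] -/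
theorem rank_hankelSq_dualSeq_eq_succ_add_rank_mod {e t c' d q' : ℕ} (he : e = c' + q' + 1) (ht : t = c' + d + 1) (hdq : d ≤ q') {P Q : K[X]} (hP : P.Monic) (hPd : P.natDegree = e + 1)
    (hQ : Q ≠ 0) (hQd : Q.natDegree = q' + 1) :
    (hankelSq K t (dualSeq K P Q)).rank = (c' + 1) + (hankelSq K d (dualSeq K (Q * C Q.leadingCoeff⁻¹) (-(P % Q)))).rank := by
  classical
  obtain ⟨hQeq, hQm, hQmd⟩ := eq_leadingCoeff_smul_mul_C_inv hQ
  rw [hQd] at hQmd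
  conv_lhs => rw [hQeq]
  rw [hankelSq_dualSeq_smul, rank_smul_of_ne_zero _ (Polynomial.leadingCoeff_ne_zero.2 hQ), rank_hankelSq_dualSeq_eq_succ_add_rank_modByMonic he ht hdq hP hPd hQm hQmd, ← Polynomial.mod_def]

variable [LinearOrder K] [IsStrictOrderedRing K]

/-- Inertia of `c • H`: kept for `c > 0`, swapped for `c < 0`. [bookkeeping; Literature `sigPos ∕ sigNeg_smul_of_pos' ∕ _neg'`, `toQuadraticForm'_smul`] -/
theorem sigPos_sigNeg_smul_matrix {n : Type*} [Fintype n] [DecidableEq n] (H : Matrix n n K) (c : K) :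
    (0 < c → sigPos (c • H).toQuadraticForm' = sigPos H.toQuadraticForm' ∧ sigNeg (c • H).toQuadraticForm' = sigNeg H.toQuadraticForm')
      ∧ (c < 0 → sigPos (c • H).toQuadraticForm' = sigNeg H.toQuadraticForm' ∧ sigNeg (c • H).toQuadraticForm' = sigPos H.toQuadraticForm') := by
  refine ⟨fun h => ?_, fun h => ?_⟩
  · rw [toQuadraticForm'_smul, sigPos_smul_of_pos' _ h, sigNeg_smul_of_pos' _ h]; exact ⟨rfl, rfl⟩
  · rw [toQuadraticForm'_smul, sigPos_smul_of_neg' _ h, sigNeg_smul_of_neg' _ h]; exact ⟨rfl, rfl⟩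

/-- **`Sign(c • H) = sign(c) · Sign(H)`** for `c ≠ 0`. [this file, §821] -/
theorem sigPos_sub_sigNeg_smul_matrix {n : Type*} [Fintype n] [DecidableEq n] (H : Matrix n n K) {c : K} (hc : c ≠ 0) :
    (sigPos (c • H).toQuadraticForm' : ℤ) - sigNeg (c • H).toQuadraticForm' = (SignType.sign c : ℤ) * ((sigPos H.toQuadraticForm' : ℤ) - sigNeg H.toQuadraticForm') := by
  obtain ⟨hp, hn⟩ := sigPos_sigNeg_smul_matrix H c
  rcases hc.lt_or_gt with h | h
  · obtain ⟨h1, h2⟩ := hn h; rw [h1, h2, sign_neg h, SignType.coe_neg_one]; ring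
  · obtain ⟨h1, h2⟩ := hp h; rw [h1, h2, sign_pos h, SignType.coe_one, one_mul]

/-- **BPR LEMMA 9.22 for `Q/P` with a NON-MONIC numerator: `Sign H_t(Q/P) = sign(lc Q) · (Sign H_d(−(P mod Q)/Q̃) + [c' even])`**, `Q̃ = Q · C lc(Q)⁻¹`, for `P` monic of degree
`(c' + 1) + deg Q`, `deg Q = q' + 1`, `Q ≠ 0`, `t + 1 = (c'+1) + (d+1)`, `d ≤ q'` (BPR's `sign(s_{c−1}) = sign(b_q/a_p)` with `a_p = 1`; N165 for the monic associate, §821 scaling). [this file, §821] -/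
theorem sigPos_sub_sigNeg_hankelSq_dualSeq_mod {e t c' d q' : ℕ} (he : e = c' + q' + 1) (ht : t = c' + d + 1) (hdq : d ≤ q') {P Q : K[X]} (hP : P.Monic) (hPd : P.natDegree = e + 1) (hQ : Q ≠ 0)
    (hQd : Q.natDegree = q' + 1) :
    (sigPos (hankelSq K t (dualSeq K P Q)).toQuadraticForm' : ℤ) - sigNeg (hankelSq K t (dualSeq K P Q)).toQuadraticForm'
      = (SignType.sign Q.leadingCoeff : ℤ) * ((sigPos (hankelSq K d (dualSeq K (Q * C Q.leadingCoeff⁻¹) (-(P % Q)))).toQuadraticForm' : ℤ)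
          - sigNeg (hankelSq K d (dualSeq K (Q * C Q.leadingCoeff⁻¹) (-(P % Q)))).toQuadraticForm' + if Even (c' + 1) then 0 else 1) := by
  classical
  obtain ⟨hQeq, hQm, hQmd⟩ := eq_leadingCoeff_smul_mul_C_inv hQ
  rw [hQd] at hQmd
  conv_lhs => rw [hQeq]
  rw [hankelSq_dualSeq_smul, sigPos_sub_sigNeg_smul_matrix _ (Polynomial.leadingCoeff_ne_zero.2 hQ), sigPos_sub_sigNeg_hankelSq_dualSeq_modByMonic he ht hdq hP hPd hQm hQmd, ← Polynomial.mod_def]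

/-- **The two indices with a non-monic numerator**: for `lc Q > 0`, `sigPos H_t(Q/P) = sigPos H_d(−(P mod Q)/Q̃) + ⌊(c'+1)/2⌋ + [c' even]` and `sigNeg H_t(Q/P) = sigNeg H_d(…) + ⌊(c'+1)/2⌋`; for
`lc Q < 0` the roles of `sigPos` and `sigNeg` on the left are exchanged. [this file, §821] -/
theorem sigPos_sigNeg_hankelSq_dualSeq_mod {e t c' d q' : ℕ} (he : e = c' + q' + 1) (ht : t = c' + d + 1) (hdq : d ≤ q') {P Q : K[X]} (hP : P.Monic) (hPd : P.natDegree = e + 1) (hQ : Q ≠ 0)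
    (hQd : Q.natDegree = q' + 1) :
    (0 < Q.leadingCoeff →
        sigPos (hankelSq K t (dualSeq K P Q)).toQuadraticForm' = sigPos (hankelSq K d (dualSeq K (Q * C Q.leadingCoeff⁻¹) (-(P % Q)))).toQuadraticForm' + (c' + 1) / 2 + (if Even (c' + 1) then 0 else 1)
          ∧ sigNeg (hankelSq K t (dualSeq K P Q)).toQuadraticForm' = sigNeg (hankelSq K d (dualSeq K (Q * C Q.leadingCoeff⁻¹) (-(P % Q)))).toQuadraticForm' + (c' + 1) / 2)
      ∧ (Q.leadingCoeff < 0 →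
        sigNeg (hankelSq K t (dualSeq K P Q)).toQuadraticForm' = sigPos (hankelSq K d (dualSeq K (Q * C Q.leadingCoeff⁻¹) (-(P % Q)))).toQuadraticForm' + (c' + 1) / 2 + (if Even (c' + 1) then 0 else 1)
          ∧ sigPos (hankelSq K t (dualSeq K P Q)).toQuadraticForm' = sigNeg (hankelSq K d (dualSeq K (Q * C Q.leadingCoeff⁻¹) (-(P % Q)))).toQuadraticForm' + (c' + 1) / 2) := by
  classical
  obtain ⟨hQeq, hQm, hQmd⟩ := eq_leadingCoeff_smul_mul_C_inv hQ
  rw [hQd] at hQmd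
  obtain ⟨h1, h2⟩ := sigPos_sigNeg_hankelSq_dualSeq_modByMonic he ht hdq hP hPd hQm hQmd
  rw [Polynomial.modByMonic_eq_mod P hQm, show Q * C Q.leadingCoeff⁻¹ = Q * C Q.leadingCoeff⁻¹ from rfl] at h1 h2
  have hmod : P % (Q * C Q.leadingCoeff⁻¹) = P % Q := by rw [Polynomial.mod_def, Polynomial.mod_def, (Polynomial.monic_mul_leadingCoeff_inv hQ).leadingCoeff, inv_one, C_1, mul_one]
  rw [hmod] at h1 h2
  obtain ⟨hp, hn⟩ := sigPos_sigNeg_smul_matrix (hankelSq K t (dualSeq K P (Q * C Q.leadingCoeff⁻¹))) Q.leadingCoeff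
  refine ⟨fun h => ?_, fun h => ?_⟩
  · obtain ⟨h3, h4⟩ := hp h
    rw [← hankelSq_dualSeq_smul, ← hQeq] at h3 h4
    exact ⟨by rw [h3, h1], by rw [h4, h2]⟩
  · obtain ⟨h3, h4⟩ := hn h
    rw [← hankelSq_dualSeq_smul, ← hQeq] at h3 h4
    exact ⟨by rw [h4, h1], by rw [h3, h2]⟩

end Scaling

end Summit.Ventures.HSemireg.Wedge.HankelOuter
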